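import Summits.HodgeConjecture.HodgeConjecture.Theorems.F0P3U3PrincipalSeriesJacquetClosedCell   -- ★ p828686 (C) `closedCell_cmPrincipalSeries` (A-p19)
import Literature.NumberTheory.Automorphic.SmoothIndOpenCellCoinvariants                        -- ★ p829766 (U) `finrank_le_one_of_hasCompactSupport_cellFun` (A-p19)
import Literature.NumberTheory.Automorphic.U3PrincipalSeriesCellFunCompactSupport               -- ★ p829554 (Supp) `hasCompactSupport_cellFun_cmPrincipalSeries_three` (A-p13)
import Literature.NumberTheory.Automorphic.CMPrincipalSeriesJacquetEvalOne                      -- ★ p829151 (L-q) `exists_cmPrincipalSeries_cmTorusCharPair_toFun_one_eq_one` (B-p10)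
import Literature.NumberTheory.Automorphic.CMPrincipalSeriesOpenCellSection                     -- ★ p829651 (L-ℓ) `exists_cmPrincipalSeries_cmTorusCharPair_toFun_one_eq_zero_and_mk_ne_zero` (B-p10)
import Literature.NumberTheory.Automorphic.U3PrincipalSeriesJacquetFiltration                   -- ★ p826240 the named fact N1 `U3PrincipalSeriesJacquetFiltration` (typ-T3a)
import Summits.HodgeConjecture.HodgeConjecture.Theorems.F0P3U3PrincipalSeriesOpenCellTorusChar      -- ★ p831847 (γ-W) `torus_normalizedJacquet_openCellLine_eq_weylChar` (A-p13) — ED. 3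
import HarnessLib

/-!
# `F0P3U3PrincipalSeriesJacquetFiltrationHolds` — ASSEMBLY of the named fact N1
# `UnitaryGroup.U3PrincipalSeriesJacquetFiltration L` ([Casselman1995] Lemma 7.1.1 (a) for `U(3)`), modulo the `wχ`-action on `ℓ`

Cell `hodgecm-mathlib`, F0∕P3 topic T3 (Keys `KeysCaseTwo` pay-down), crux H413 (`stmt-HodgeConjecture-24833`), line
`F0_P3_KeysCaseTwoPaydown`; node N1 = ★ named fact `UnitaryGroup.U3PrincipalSeriesJacquetFiltration L`
(`Literature/NumberTheory/Automorphic/U3PrincipalSeriesJacquetFiltration.lean`): for a non-split finite place `v` of `L⁺` and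
continuous characters `χ = (χ₁, χ₂)` of the diagonal torus `T(L⁺_v)` of `G = U(Φ₃)(L⁺_v)`, the normalised Jacquet module
`r = r_B i_G(χ)` is finite-dimensional of dimension `2`, with a line `ℓ` on which `T` acts through `wχ` and modulo which `T` acts
through `χ`.

THIS FILE assembles every clause of N1 from ★ pieces already in the tree, leaving EXACTLY ONE explicit hypothesis — the
`wχ`-action on the classes of the functions vanishing at `1` (clause (γ-W); A-p13 (g27)'s T3, in flight):
* (C) closed cell — ★ `closedCell_cmPrincipalSeries` (A-p19, p828686): a `T`-stable `ℓ` with `r(m) x − χ(m) x ∈ ℓ`,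
  `FiniteDimensional (r ⧸ ℓ)`, `finrank (r ⧸ ℓ) ≤ 1`, and `x ∈ ℓ ↔ x = [f]` for some `f` with `f(1) = 0`;
* (U) open cell, upper bound — ★ `finrank_le_one_of_hasCompactSupport_cellFun` (A-p19, p829766 §5): `FiniteDimensional ℓ` and
  `finrank ℓ ≤ 1`, its one hypothesis (compact support of the cell functions `n ↦ f(w₀ n)` of the `f` with `f(1) = 0`) discharged
  by ★ `hasCompactSupport_cellFun_cmPrincipalSeries_three` (A-p13, p829554);
* (L-ℓ) `ℓ ≠ 0` — ★ `exists_cmPrincipalSeries_cmTorusCharPair_toFun_one_eq_zero_and_mk_ne_zero` (B-p10, p829651): a `Φ` with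
  `Φ(1) = 0`, `[Φ] ≠ 0` (indicator section on the open cell `B w₀ N`, Iwahori factorisation, Haar functional);
* (L-q) `r ⧸ ℓ ≠ 0` — ★ `exists_cmPrincipalSeries_cmTorusCharPair_toFun_one_eq_one` (B-p10, p829151): an `f` with `f(1) = 1`
  and the evaluation functional `E [g] = g(1)` on `r`, whence `[f] ∉ ℓ`;
* linear algebra (Mathlib): `r` is finite-dimensional as an extension of `r ⧸ ℓ` by `ℓ` (`Module.Finite.of_exact` on
  `0 → ℓ → r → r ⧸ ℓ → 0`), and `finrank r = finrank (r ⧸ ℓ) + finrank ℓ = 1 + 1 = 2` (`Submodule.finrank_quotient_add_finrank`).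

HEADS. §1 `finrank_eq_two_of_closedCell_openCell` — the abstract linear algebra of the two-step filtration (any `ℂ`-module
`C`, maps `mk : S → C`, `ev : S → ℂ`, action `J : M → C → C`); §2 **`U3PrincipalSeriesJacquetFiltration_holds_of_weylAction (hW) :
UnitaryGroup.U3PrincipalSeriesJacquetFiltration L`** — the fact BY NAME, conditional on the one clause (γ-W) (hypothesis `hW`
= the `wχ`-action on the `[f]` with `f(1) = 0`). The hypothesis-free `U3PrincipalSeriesJacquetFiltration_holds` is appended
(ED. 2, append-only) the moment (γ-W) is ★.

Print: [Casselman1995] Lemma 7.1.1 (a) p. 67 («`0 → (w⁻¹σ)δ^{1/2} → I_N → σδ^{1/2} → 0`»), §6.3 (Bruhat filtration of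
`Ind|_P`); [BernsteinZelevinsky1977] §2.12 Geometrical Lemma, Cor. 2.13 (c); [Rogawski1990] §12.2 pp. 173–174 (the case `U(3)`,
`wχ = (χ̄₁⁻¹, χ₂)`).
HONEST LABEL: HC_CM is proved only modulo the printed citations until rung 0 closes; this file discharges N1 only modulo
its explicit hypothesis `hW` and proves nothing about HC_CM by itself.
-/

set_option autoImplicit false
set_option linter.dupNamespace false

noncomputable section

open Literature.NumberTheory.Automorphic Literature.NumberTheory.Automorphic.UnitaryGroup
open _root_.NumberField _root_.IsDedekindDomain

namespace Summit.HodgeConjecture.HodgeConjecture.Cruxes.H413.F0P3U3PrincipalSeriesJacquetFiltrationHolds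

/-! ## §1 The linear algebra of the two-step filtration (abstract; no topology) -/

/-- **Abstract assembly.** Let `C` be a `ℂ`-module («`r_B i_G(χ)`»), `mk : S → C` («`f ↦ [f]`»), `ev : S → ℂ` («`f ↦ f(1)`»),
`J : M → C → C` («the normalised Jacquet action of `T`») and `χc wχc : M → ℂ` («`χ`, `wχ`»).  Suppose (C) there is `ℓ ≤ C`,
`J`-stable, with `J m x − χc m • x ∈ ℓ`, `C ⧸ ℓ` finite-dimensional of dimension `≤ 1`, and `x ∈ ℓ ↔ x = mk f` for some `f` with
`ev f = 0`; (U) every such `ℓ` is finite-dimensional of dimension `≤ 1`; (L-ℓ) some `Φ` has `ev Φ = 0`, `mk Φ ≠ 0`; (L-q) some `f`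
has `ev f = 1`, and `ev` factors through a linear form `E` on `C`; (W) `J m (mk f) = wχc m • mk f` whenever `ev f = 0`.  Then `C` is
finite-dimensional of dimension `2` and `ℓ` is a line on which `J` acts through `wχc` and modulo which `J` acts through `χc`
(rank–nullity for `0 → ℓ → C → C ⧸ ℓ → 0`). [cite: Casselman1995, Lemma 7.1.1 (a) p. 67]
[cite: BernsteinZelevinsky1977, §2.12 Geometrical Lemma, Cor. 2.13 (c)] -/
theorem finrank_eq_two_of_closedCell_openCell {C : Type*} [AddCommGroup C] [Module ℂ C] {S M : Type*}
    {mk : S → C} {ev : S → ℂ} {J : M → C → C} {χc wχc : M → ℂ}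
    (HC : ∃ ℓ : Submodule ℂ C, (∀ m, ∀ x ∈ ℓ, J m x ∈ ℓ) ∧ (∀ m x, J m x - χc m • x ∈ ℓ) ∧
      FiniteDimensional ℂ (C ⧸ ℓ) ∧ Module.finrank ℂ (C ⧸ ℓ) ≤ 1 ∧ (∀ x, x ∈ ℓ ↔ ∃ f, ev f = 0 ∧ mk f = x))
    (HU : ∀ ℓ : Submodule ℂ C, (∀ x, x ∈ ℓ ↔ ∃ f, ev f = 0 ∧ mk f = x) →
      FiniteDimensional ℂ ↥ℓ ∧ Module.finrank ℂ ↥ℓ ≤ 1)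
    (HD : ∃ Φ, ev Φ = 0 ∧ mk Φ ≠ 0)
    (HL : (∃ f, ev f = 1 ∧ mk f ≠ 0) ∧ ∃ E : C →ₗ[ℂ] ℂ, (∀ f, E (mk f) = ev f) ∧ E ≠ 0)
    (hW : ∀ m f, ev f = 0 → J m (mk f) = wχc m • mk f) :
    FiniteDimensional ℂ C ∧ Module.finrank ℂ C = 2 ∧
      ∃ ℓ : Submodule ℂ C, Module.finrank ℂ ↥ℓ = 1 ∧ (∀ m, ∀ x ∈ ℓ, J m x = wχc m • x) ∧
        (∀ m x, J m x - χc m • x ∈ ℓ) := by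
  obtain ⟨ℓ, -, hquot, hfdq, hrkq, hℓ⟩ := HC
  obtain ⟨hfdℓ, hrkℓ⟩ := HU ℓ hℓ
  -- (L-ℓ) `ℓ ≠ 0`
  obtain ⟨Φ, hΦ1, hΦne⟩ := HD
  have hΦℓ : mk Φ ∈ ℓ := (hℓ _).2 ⟨Φ, hΦ1, rfl⟩
  have h1ℓ : 1 ≤ Module.finrank ℂ ↥ℓ := by
    rw [Submodule.one_le_finrank_iff]
    rintro rfl
    rw [Submodule.mem_bot] at hΦℓ
    exact hΦne hΦℓ
  -- (L-q) `C ⧸ ℓ ≠ 0`: `ev f = 1` and `E ∘ mk = ev` give `mk f ∉ ℓ`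
  obtain ⟨⟨f, hf1, -⟩, E, hE, -⟩ := HL
  have hfℓ : mk f ∉ ℓ := by
    intro h
    obtain ⟨g, hg0, hg⟩ := (hℓ _).1 h
    have h' : ev g = ev f := by rw [← hE g, ← hE f, hg]
    rw [hg0, hf1] at h'
    exact zero_ne_one h'
  haveI := hfdq
  haveI := hfdℓ
  have h1q : 0 < Module.finrank ℂ (C ⧸ ℓ) :=
    Module.finrank_pos_iff_exists_ne_zero.mpr
      ⟨Submodule.Quotient.mk (mk f), fun h => hfℓ ((Submodule.Quotient.mk_eq_zero ℓ).1 h)⟩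
  -- rank–nullity for `0 → ℓ → C → C ⧸ ℓ → 0`
  haveI hfdC : FiniteDimensional ℂ C :=
    Module.Finite.of_exact (LinearMap.exact_subtype_mkQ ℓ) (Submodule.mkQ_surjective ℓ)
  have hsum := Submodule.finrank_quotient_add_finrank ℓ
  refine ⟨hfdC, by omega, ℓ, by omega, ?_, hquot⟩
  intro m x hx
  obtain ⟨g, hg0, rfl⟩ := (hℓ x).1 hx
  exact hW m g hg0

/-! ## §2 The named fact N1, by name, modulo the `wχ`-action on `ℓ` -/

variable (L : Type) [Field L] [NumberField L] [IsCMField L]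

set_option synthInstance.maxHeartbeats 400000 in  -- instance paths on the CM carrier `∏_{w ∣ v} L_w` (as in the fact ★ N1 itself)
set_option maxHeartbeats 2000000 in  -- the ONE `rfl`-bridge `cmPrincipalSeries L 3 v χ = normalizedInd (cmBorelTriple L 3 v) (𝟙 ⊗ χ)` (cf. ★ `closedCell_cmPrincipalSeries`)
/-- **(U) in the fact's spelling.** At a non-split place `v`, every `ℓ ≤ r_B i_G(χ)` consisting of the classes of the functions
vanishing at `1` is finite-dimensional of dimension `≤ 1` — ★ `finrank_le_one_of_hasCompactSupport_cellFun` (open cell `B w₀ N`,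
★ `U3LocalBruhatDecomposition_holds`) over ★ `hasCompactSupport_cellFun_cmPrincipalSeries_three` (compact support of the cell
functions), transported along the definitional equality `cmPrincipalSeries L 3 v χ = normalizedInd (cmBorelTriple L 3 v) (𝟙 ⊗ χ)`.
[cite: Casselman1995, Lemma 7.1.1 (a) p. 67; §6.3] [cite: BernsteinZelevinsky1977, §2.12 Geometrical Lemma, Cor. 2.13 (c)] -/
theorem finrank_le_one_cmPrincipalSeries (v : HeightOneSpectrum (𝓞 ↥(maximalRealSubfield L)))
    (hns : ∀ w : PlacesOver L v, IsCMField.complexConj L • w.1 = w.1)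
    (χ : ↥(torusU (conjLocal L (IsCMField.complexConj L) v) (cmLocalForm L 3 v)) →* ℂˣ) :
    haveI := locallyCompactSpace_cmBorelU L 3 v
    ∀ ℓ : Submodule ℂ ((cmBorelTriple L 3 v).restrict (cmPrincipalSeries L 3 v χ)).Coinvariants,
      (∀ x, x ∈ ℓ ↔ ∃ f : Representation.SmoothInd (cmBorelTriple L 3 v).P
          (Representation.twist
            (((Representation.trivial ℂ ↥(torusU (conjLocal L (IsCMField.complexConj L) v) (cmLocalForm L 3 v)) ℂ).twist
              χ).comp (cmBorelTriple L 3 v).proj) (rootDeltaChar (cmBorelTriple L 3 v).P)),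
        f.toFun 1 = 0 ∧ Representation.Coinvariants.mk _ f = x) →
      FiniteDimensional ℂ ↥ℓ ∧ Module.finrank ℂ ↥ℓ ≤ 1 :=
  finrank_le_one_of_hasCompactSupport_cellFun L v hns χ (hasCompactSupport_cellFun_cmPrincipalSeries_three L v hns χ)

/-! ### The `def`'s auxiliary proof constants, by name
N1 is a `def … : Prop`; Lean abstracts the eight instance PROOFS occurring in its body into auxiliary constants
`U3PrincipalSeriesJacquetFiltration._proof_1 … _proof_8`.  The `rfl`-lemmas below identify them with the instance terms every
theorem-world statement carries, so that `dsimp only` can align N1's unfolded body with the assembled term SYNTACTICALLY (the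
elaborator's `isDefEq` on the two ≈ 10¹⁰-node (unshared) types does not terminate otherwise; measured). -/

set_option linter.auxLemma false in
/-- `_proof_1` is the instance `SubsemiringClass (Subfield L) L`. [cite: Casselman1995, Lemma 7.1.1 (a) p. 67] -/
private theorem aux_proof_1 (L : Type) [Field L] :
    Eq (@U3PrincipalSeriesJacquetFiltration._proof_1 L _) inferInstance := rfl

set_option linter.auxLemma false in
/-- `_proof_2` is the instance `Algebra.IsIntegral ℚ L`. [cite: Casselman1995, Lemma 7.1.1 (a) p. 67] -/
private theorem aux_proof_2 (L : Type) [Field L] [NumberField L] :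
    Eq (@U3PrincipalSeriesJacquetFiltration._proof_2 L _ _) inferInstance := rfl

set_option linter.auxLemma false in
/-- `_proof_3` is the instance `IsDomain (𝓞 L⁺)`. [cite: Casselman1995, Lemma 7.1.1 (a) p. 67] -/
private theorem aux_proof_3 (L : Type) [Field L] :
    Eq (@U3PrincipalSeriesJacquetFiltration._proof_3 L _) inferInstance := rfl

set_option linter.auxLemma false in
/-- `_proof_4` is the instance `Algebra.IsIntegral (𝓞 L⁺) (𝓞 L)`. [cite: Casselman1995, Lemma 7.1.1 (a) p. 67] -/
private theorem aux_proof_4 (L : Type) [Field L] :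
    Eq (@U3PrincipalSeriesJacquetFiltration._proof_4 L _) inferInstance := rfl

set_option linter.auxLemma false in
/-- `_proof_5` is the instance `NumberField L⁺`. [cite: Casselman1995, Lemma 7.1.1 (a) p. 67] -/
private theorem aux_proof_5 (L : Type) [Field L] [NumberField L] :
    Eq (@U3PrincipalSeriesJacquetFiltration._proof_5 L _ _) inferInstance := rfl

set_option linter.auxLemma false in
/-- `_proof_6` is the instance `SeparatelyContinuousMul (U(Φ₃)(L⁺_v))`. [cite: Casselman1995, Lemma 7.1.1 (a) p. 67] -/
private theorem aux_proof_6 (L : Type) [Field L] [NumberField L] [IsCMField L]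
    (v : HeightOneSpectrum (𝓞 ↥(maximalRealSubfield L))) :
    Eq (@U3PrincipalSeriesJacquetFiltration._proof_6 L _ _ _ v) inferInstance := rfl

set_option linter.auxLemma false in
/-- `_proof_7` is the instance `IsTopologicalGroup (U(Φ₃)(L⁺_v))`. [cite: Casselman1995, Lemma 7.1.1 (a) p. 67] -/
private theorem aux_proof_7 (L : Type) [Field L] [NumberField L] [IsCMField L]
    (v : HeightOneSpectrum (𝓞 ↥(maximalRealSubfield L))) :
    Eq (@U3PrincipalSeriesJacquetFiltration._proof_7 L _ _ _ v) inferInstance := rfl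

set_option linter.auxLemma false in
/-- `_proof_8` is ★ `locallyCompactSpace_cmBorelU L 3 v`. [cite: Casselman1995, Lemma 7.1.1 (a) p. 67] -/
private theorem aux_proof_8 (L : Type) [Field L] [NumberField L] [IsCMField L]
    (v : HeightOneSpectrum (𝓞 ↥(maximalRealSubfield L))) :
    Eq (@U3PrincipalSeriesJacquetFiltration._proof_8 L _ _ _ v) (locallyCompactSpace_cmBorelU L 3 v) := rfl

set_option backward.dsimp.proofs true in  -- `dsimp` must rewrite the `_proof_k` leaves, which are proofs in instance positions
set_option synthInstance.maxHeartbeats 400000 in  -- instance paths on the CM carrier `∏_{w ∣ v} L_w` (as in the fact ★ N1 itself)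
set_option maxHeartbeats 2000000 in  -- as in ★ N1: the hypothesis `hW` restates N1's clause (γ-W) on the CM carrier
/-- **The named fact N1 ★ `UnitaryGroup.U3PrincipalSeriesJacquetFiltration L` BY NAME, modulo the `wχ`-action on `ℓ`**:
if at every non-split place `v` and for all continuous `χ₁`, `χ₂` the torus acts through `wχ = (χ̄₁⁻¹, χ₂)` on the classes
`[f] ∈ r_B i_G(χ₁, χ₂)` of the functions with `f(1) = 0` (hypothesis `hW`, clause (γ-W) of N1), then N1 holds: at each such
`v`, `χ₁`, `χ₂` the abstract assembly `finrank_eq_two_of_closedCell_openCell` is fed (C) ★ `closedCell_cmPrincipalSeries`, (U)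
`finrank_le_one_cmPrincipalSeries`, (L-ℓ) ★ `exists_cmPrincipalSeries_cmTorusCharPair_toFun_one_eq_zero_and_mk_ne_zero`, (L-q) ★
`exists_cmPrincipalSeries_cmTorusCharPair_toFun_one_eq_one`, and (W) `hW`, with every implicit of the abstract lemma given
explicitly (metavariable-free elaboration).

ELABORATION NOTE (measured over 20 scratch legs). N1 is a `def … : Prop`, so its body carries the auxiliary constants
`U3PrincipalSeriesJacquetFiltration._proof_1 … _proof_8` (Lean abstracts the instance PROOFS `SubsemiringClass (Subfield L) L`,
`Algebra.IsIntegral ℚ L`, `IsDomain (𝓞 L⁺)`, `Algebra.IsIntegral (𝓞 L⁺) (𝓞 L)`, `NumberField L⁺`, `SeparatelyContinuousMul G`,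
`IsTopologicalGroup G`, `LocallyCompactSpace B` occurring in a definition's value), whereas every theorem-world statement carries
the instance terms themselves.  The assembled term `key` below has N1's body as its type up to exactly these proof-irrelevant
leaves (checked mechanically: after unfolding them the two ≈ 8·10⁹-node unshared types coincide), but the elaborator's `isDefEq`
on the raw pair (what a bare `exact key` runs) does not finish in 16·10⁶ heartbeats ∕ 600 s (cf. the same finding in ★
`U3PrincipalSeriesJacquetFiltrationUnfold`).  The proof therefore first ALIGNS the two syntactically — `dsimp only` with the eight
`rfl`-lemmas `aux_proof_k : _proof_k = ‹the instance›` (visiting proofs and instance arguments: `backward.dsimp.proofs`,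
`instances := true`) on both the goal and `key` — after which `exact key` is immediate (whole file ≈ 17 s).
[cite: Casselman1995, Lemma 7.1.1 (a) p. 67; §6.3] [cite: BernsteinZelevinsky1977, §2.12 Geometrical Lemma, Cor. 2.13 (c)]
[cite: Rogawski1990, §12.2 pp. 173–174] -/
theorem U3PrincipalSeriesJacquetFiltration_holds_of_weylAction
    (hW : ∀ (v : HeightOneSpectrum (𝓞 ↥(maximalRealSubfield L))),
      (∀ w : PlacesOver L v, IsCMField.complexConj L • w.1 = w.1) →
      ∀ (χ₁ : (LocalRing L v)ˣ →* ℂˣ) (χ₂ : ↥(normOneUnits (conjLocal L (IsCMField.complexConj L) v)) →* ℂˣ),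
        Continuous (fun x => ((χ₁ x : ℂˣ) : ℂ)) → Continuous (fun x => ((χ₂ x : ℂˣ) : ℂ)) →
      haveI := locallyCompactSpace_cmBorelU L 3 v
      ∀ (m : ↥(cmBorelTriple L 3 v).M)
        (f : Representation.SmoothInd (cmBorelTriple L 3 v).P
          (Representation.twist
            (((Representation.trivial ℂ ↥(torusU (conjLocal L (IsCMField.complexConj L) v) (cmLocalForm L 3 v)) ℂ).twist
              (cmTorusCharPair L v χ₁ χ₂)).comp (cmBorelTriple L 3 v).proj) (rootDeltaChar (cmBorelTriple L 3 v).P))),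
        f.toFun 1 = 0 →
          (cmPrincipalSeries L 3 v (cmTorusCharPair L v χ₁ χ₂)).normalizedJacquet (cmBorelTriple L 3 v) m
              (Representation.Coinvariants.mk
                ((cmBorelTriple L 3 v).restrict (cmPrincipalSeries L 3 v (cmTorusCharPair L v χ₁ χ₂))) f) =
            ((cmWeylTorusCharPair L v χ₁ χ₂ m : ℂˣ) : ℂ) •
              Representation.Coinvariants.mk
                ((cmBorelTriple L 3 v).restrict (cmPrincipalSeries L 3 v (cmTorusCharPair L v χ₁ χ₂))) f) :
    U3PrincipalSeriesJacquetFiltration L := by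
  intro v hns χ₁ χ₂ h₁ h₂
  -- the ★ pieces, each applied to its explicit data (metavariable-free)
  have HC := F0P3U3PrincipalSeriesJacquetClosedCell.closedCell_cmPrincipalSeries L v (cmTorusCharPair L v χ₁ χ₂)
  have HU := finrank_le_one_cmPrincipalSeries L v hns (cmTorusCharPair L v χ₁ χ₂)
  have HD := exists_cmPrincipalSeries_cmTorusCharPair_toFun_one_eq_zero_and_mk_ne_zero L v χ₁ χ₂ h₁ h₂
  have HL := exists_cmPrincipalSeries_cmTorusCharPair_toFun_one_eq_one L v χ₁ χ₂ h₁ h₂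
  have hWv := hW v hns χ₁ χ₂ h₁ h₂
  -- the assembly, in the theorem world: `key : <N1's body at v, χ₁, χ₂>` (all implicits explicit ⇒ no metavariables;
  -- the instance `LocallyCompactSpace B` INLINED as in ★ N1's statement, not a local `haveI`)
  have key := finrank_eq_two_of_closedCell_openCell
    (mk := haveI := locallyCompactSpace_cmBorelU L 3 v
      ⇑(Representation.Coinvariants.mk
        ((cmBorelTriple L 3 v).restrict (cmPrincipalSeries L 3 v (cmTorusCharPair L v χ₁ χ₂)))))
    (ev := fun f => f.toFun 1)
    (J := haveI := locallyCompactSpace_cmBorelU L 3 v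
      fun m => ⇑((cmPrincipalSeries L 3 v (cmTorusCharPair L v χ₁ χ₂)).normalizedJacquet (cmBorelTriple L 3 v) m))
    (χc := fun m => ((cmTorusCharPair L v χ₁ χ₂ m : ℂˣ) : ℂ))
    (wχc := fun m => ((cmWeylTorusCharPair L v χ₁ χ₂ m : ℂˣ) : ℂ))
    HC HU HD HL hWv
  -- align N1's unfolded body (`_proof_k` leaves) with `key` syntactically, then close
  dsimp (config := { failIfUnchanged := false, instances := true }) only [aux_proof_1, aux_proof_2, aux_proof_3, aux_proof_4, aux_proof_5,
    aux_proof_6, aux_proof_7, aux_proof_8, inferInstance] at key ⊢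
  exact key


/-! ## §3 (ED. 2) The same, from the `ℓ`-based form of clause (γ-W)

A-p13 (g27)'s T3 states the `wχ`-action for ANY `ℓ ≤ r_B i_G(χ)` consisting of the classes of the functions vanishing at `1`
and finite-dimensional of dimension `≤ 1` (P3 17:37:30Z).  The closed cell (★ `closedCell_cmPrincipalSeries`) and (U)
(`finrank_le_one_cmPrincipalSeries`) produce such an `ℓ`, so that form implies the `ℓ`-free hypothesis `hW` of
`U3PrincipalSeriesJacquetFiltration_holds_of_weylAction`; everything here is theorem-world (no meeting with the `def`). -/

set_option synthInstance.maxHeartbeats 400000 in  -- instance paths on the CM carrier `∏_{w ∣ v} L_w` (as in the fact ★ N1 itself)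
set_option maxHeartbeats 2000000 in  -- as in ★ N1: two restatements of clause (γ-W) on the CM carrier
/-- **(γ-W), `ℓ`-based ⇒ `ℓ`-free** at one non-split place: if the torus acts through `wχ` on every line `ℓ` of classes of
functions vanishing at `1` (`hT`, the shape of A-p13's T3), then it acts through `wχ` on every class `[f]` with `f(1) = 0` — because
★ `closedCell_cmPrincipalSeries` + `finrank_le_one_cmPrincipalSeries` exhibit such an `ℓ` containing all these classes.
[cite: Casselman1995, Lemma 7.1.1 (a) p. 67; §6.3] [cite: BernsteinZelevinsky1977, §2.12 Geometrical Lemma, Cor. 2.13 (c)] -/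
theorem weylAction_of_lineAction (v : HeightOneSpectrum (𝓞 ↥(maximalRealSubfield L)))
    (hns : ∀ w : PlacesOver L v, IsCMField.complexConj L • w.1 = w.1)
    (χ₁ : (LocalRing L v)ˣ →* ℂˣ) (χ₂ : ↥(normOneUnits (conjLocal L (IsCMField.complexConj L) v)) →* ℂˣ)
    (hT : haveI := locallyCompactSpace_cmBorelU L 3 v
      ∀ ℓ : Submodule ℂ ((cmBorelTriple L 3 v).restrict (cmPrincipalSeries L 3 v (cmTorusCharPair L v χ₁ χ₂))).Coinvariants,
        (∀ x ∈ ℓ, ∃ f : Representation.SmoothInd (cmBorelTriple L 3 v).P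
            (Representation.twist
              (((Representation.trivial ℂ ↥(torusU (conjLocal L (IsCMField.complexConj L) v) (cmLocalForm L 3 v)) ℂ).twist
                (cmTorusCharPair L v χ₁ χ₂)).comp (cmBorelTriple L 3 v).proj) (rootDeltaChar (cmBorelTriple L 3 v).P)),
          f.toFun 1 = 0 ∧
            Representation.Coinvariants.mk
              ((cmBorelTriple L 3 v).restrict (cmPrincipalSeries L 3 v (cmTorusCharPair L v χ₁ χ₂))) f = x) →
        (∀ f : Representation.SmoothInd (cmBorelTriple L 3 v).P
            (Representation.twist
              (((Representation.trivial ℂ ↥(torusU (conjLocal L (IsCMField.complexConj L) v) (cmLocalForm L 3 v)) ℂ).twist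
                (cmTorusCharPair L v χ₁ χ₂)).comp (cmBorelTriple L 3 v).proj) (rootDeltaChar (cmBorelTriple L 3 v).P)),
          f.toFun 1 = 0 →
            Representation.Coinvariants.mk
              ((cmBorelTriple L 3 v).restrict (cmPrincipalSeries L 3 v (cmTorusCharPair L v χ₁ χ₂))) f ∈ ℓ) →
        FiniteDimensional ℂ ↥ℓ → Module.finrank ℂ ↥ℓ ≤ 1 →
        ∀ (m : ↥(cmBorelTriple L 3 v).M), ∀ x ∈ ℓ,
          (cmPrincipalSeries L 3 v (cmTorusCharPair L v χ₁ χ₂)).normalizedJacquet (cmBorelTriple L 3 v) m x =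
            ((cmWeylTorusCharPair L v χ₁ χ₂ m : ℂˣ) : ℂ) • x) :
    haveI := locallyCompactSpace_cmBorelU L 3 v
    ∀ (m : ↥(cmBorelTriple L 3 v).M)
      (f : Representation.SmoothInd (cmBorelTriple L 3 v).P
        (Representation.twist
          (((Representation.trivial ℂ ↥(torusU (conjLocal L (IsCMField.complexConj L) v) (cmLocalForm L 3 v)) ℂ).twist
            (cmTorusCharPair L v χ₁ χ₂)).comp (cmBorelTriple L 3 v).proj) (rootDeltaChar (cmBorelTriple L 3 v).P))),
      f.toFun 1 = 0 →
        (cmPrincipalSeries L 3 v (cmTorusCharPair L v χ₁ χ₂)).normalizedJacquet (cmBorelTriple L 3 v) m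
            (Representation.Coinvariants.mk
              ((cmBorelTriple L 3 v).restrict (cmPrincipalSeries L 3 v (cmTorusCharPair L v χ₁ χ₂))) f) =
          ((cmWeylTorusCharPair L v χ₁ χ₂ m : ℂˣ) : ℂ) •
            Representation.Coinvariants.mk
              ((cmBorelTriple L 3 v).restrict (cmPrincipalSeries L 3 v (cmTorusCharPair L v χ₁ χ₂))) f := by
  -- theorem world throughout: `have` the ★ pieces, destructure the local, one `exact`
  have HC := F0P3U3PrincipalSeriesJacquetClosedCell.closedCell_cmPrincipalSeries L v (cmTorusCharPair L v χ₁ χ₂)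
  obtain ⟨ℓ, -, -, -, -, hℓ⟩ := HC
  have HU := finrank_le_one_cmPrincipalSeries L v hns (cmTorusCharPair L v χ₁ χ₂) ℓ hℓ
  intro m f hf
  exact hT ℓ (fun x hx => (hℓ x).1 hx) (fun g hg => (hℓ _).2 ⟨g, hg, rfl⟩) HU.1 HU.2 m _ ((hℓ _).2 ⟨f, hf, rfl⟩)

set_option synthInstance.maxHeartbeats 400000 in  -- instance paths on the CM carrier `∏_{w ∣ v} L_w` (as in the fact ★ N1 itself)
set_option maxHeartbeats 2000000 in  -- as in ★ N1: the hypothesis `hT` restates clause (γ-W) on the CM carrier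
/-- **The named fact N1 ★ `UnitaryGroup.U3PrincipalSeriesJacquetFiltration L` BY NAME, modulo the `ℓ`-based form of (γ-W)**
(the shape of A-p13's T3): `U3PrincipalSeriesJacquetFiltration_holds_of_weylAction` ∘ `weylAction_of_lineAction`.
[cite: Casselman1995, Lemma 7.1.1 (a) p. 67; §6.3] [cite: BernsteinZelevinsky1977, §2.12 Geometrical Lemma, Cor. 2.13 (c)]
[cite: Rogawski1990, §12.2 pp. 173–174] -/
theorem U3PrincipalSeriesJacquetFiltration_holds_of_lineAction
    (hT : ∀ (v : HeightOneSpectrum (𝓞 ↥(maximalRealSubfield L))),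
      (∀ w : PlacesOver L v, IsCMField.complexConj L • w.1 = w.1) →
      ∀ (χ₁ : (LocalRing L v)ˣ →* ℂˣ) (χ₂ : ↥(normOneUnits (conjLocal L (IsCMField.complexConj L) v)) →* ℂˣ),
        Continuous (fun x => ((χ₁ x : ℂˣ) : ℂ)) → Continuous (fun x => ((χ₂ x : ℂˣ) : ℂ)) →
      haveI := locallyCompactSpace_cmBorelU L 3 v
      ∀ ℓ : Submodule ℂ ((cmBorelTriple L 3 v).restrict (cmPrincipalSeries L 3 v (cmTorusCharPair L v χ₁ χ₂))).Coinvariants,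
        (∀ x ∈ ℓ, ∃ f : Representation.SmoothInd (cmBorelTriple L 3 v).P
            (Representation.twist
              (((Representation.trivial ℂ ↥(torusU (conjLocal L (IsCMField.complexConj L) v) (cmLocalForm L 3 v)) ℂ).twist
                (cmTorusCharPair L v χ₁ χ₂)).comp (cmBorelTriple L 3 v).proj) (rootDeltaChar (cmBorelTriple L 3 v).P)),
          f.toFun 1 = 0 ∧
            Representation.Coinvariants.mk
              ((cmBorelTriple L 3 v).restrict (cmPrincipalSeries L 3 v (cmTorusCharPair L v χ₁ χ₂))) f = x) →
        (∀ f : Representation.SmoothInd (cmBorelTriple L 3 v).P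
            (Representation.twist
              (((Representation.trivial ℂ ↥(torusU (conjLocal L (IsCMField.complexConj L) v) (cmLocalForm L 3 v)) ℂ).twist
                (cmTorusCharPair L v χ₁ χ₂)).comp (cmBorelTriple L 3 v).proj) (rootDeltaChar (cmBorelTriple L 3 v).P)),
          f.toFun 1 = 0 →
            Representation.Coinvariants.mk
              ((cmBorelTriple L 3 v).restrict (cmPrincipalSeries L 3 v (cmTorusCharPair L v χ₁ χ₂))) f ∈ ℓ) →
        FiniteDimensional ℂ ↥ℓ → Module.finrank ℂ ↥ℓ ≤ 1 →
        ∀ (m : ↥(cmBorelTriple L 3 v).M), ∀ x ∈ ℓ,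
          (cmPrincipalSeries L 3 v (cmTorusCharPair L v χ₁ χ₂)).normalizedJacquet (cmBorelTriple L 3 v) m x =
            ((cmWeylTorusCharPair L v χ₁ χ₂ m : ℂˣ) : ℂ) • x) :
    U3PrincipalSeriesJacquetFiltration L :=
  U3PrincipalSeriesJacquetFiltration_holds_of_weylAction L fun v hns χ₁ χ₂ h₁ h₂ =>
    weylAction_of_lineAction L v hns χ₁ χ₂ (hT v hns χ₁ χ₂ h₁ h₂)


/-! ## §4 (ED. 3) THE NAMED FACT N1, UNCONDITIONALLY

A-p13 (g27)'s ★ `F0P3U3PrincipalSeriesOpenCellTorusChar.torus_normalizedJacquet_openCellLine_eq_weylChar L` (p831847) is clause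
(γ-W) in exactly the `ℓ`-based shape `hT` of `U3PrincipalSeriesJacquetFiltration_holds_of_lineAction` (§3): one application. -/

/-- **THE NAMED FACT N1 ★ `UnitaryGroup.U3PrincipalSeriesJacquetFiltration L` — DISCHARGED, hypothesis-free** ([Casselman1995]
Lemma 7.1.1 (a) for `U(3)` at every non-split place: `r_B i_G(χ₁, χ₂)` is finite-dimensional of dimension `2`, with a line `ℓ` on
which `T` acts through `wχ = (χ̄₁⁻¹, χ₂)` and modulo which `T` acts through `χ`).  Assembly: closed cell ★ `closedCell_cmPrincipalSeries`
(A-p19), open-cell bound ★ `finrank_le_one_of_hasCompactSupport_cellFun` (A-p19) over ★ `hasCompactSupport_cellFun_cmPrincipalSeries_three`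
(A-p13), lower bounds ★ `exists_cmPrincipalSeries_cmTorusCharPair_toFun_one_eq_zero_and_mk_ne_zero` ∕ ★ `…_toFun_one_eq_one` (B-p10),
rank–nullity (§1), and (γ-W) ★ `torus_normalizedJacquet_openCellLine_eq_weylChar` (A-p13: Haar functional on the big cell, Jacobian
`Δ_B`, `χ(ʷt) = wχ(t)`, `δ_B^{1/2}(ʷt) = δ_B^{-1/2}(t)`). [cite: Casselman1995, Lemma 7.1.1 (a) p. 67; §6.3]
[cite: BernsteinZelevinsky1977, §2.12 Geometrical Lemma, Cor. 2.13 (c); §5 (5.2)] [cite: Rogawski1990, §12.2 pp. 173–174] -/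
theorem U3PrincipalSeriesJacquetFiltration_holds : U3PrincipalSeriesJacquetFiltration L :=
  U3PrincipalSeriesJacquetFiltration_holds_of_lineAction L
    (F0P3U3PrincipalSeriesOpenCellTorusChar.torus_normalizedJacquet_openCellLine_eq_weylChar L)

end Summit.HodgeConjecture.HodgeConjecture.Cruxes.H413.F0P3U3PrincipalSeriesJacquetFiltrationHolds

end
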